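import Summits.RiemannHypothesis.RiemannHypothesis.Theorems.SoloInformedOnset
import Summits.RiemannHypothesis.RiemannHypothesis.Theorems.RuelleBandCofiniteCriticalLineENDIff
import Summits.RiemannHypothesis.RiemannHypothesis.Theorems.RuelleBandCofiniteCriticalLineStubCalibrationENDOfRH
import Summits.RiemannHypothesis.RiemannHypothesis.Theorems.RuelleBandCofiniteCriticalLineStubBranchesContinuous
import Summits.RiemannHypothesis.RiemannHypothesis.Theorems.HandoffLadderRungOne
import Literature.NumberTheory.DiophantineGeometry.NamedHypothesesRHProofs

/-!
# RiemannHypothesis / Splittings — Weil null-free tail (Yoshida's Theorem 2 tail, S11): `RH ⟺ W_fin(H) ∧ NonDegFrom(H)`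
hypothesis-free for every `H > 0`, and the null-free ∃-tail is FOZ (RAW zero-def form of cell rh-split, seat
(weil, neg) gen 3, card `cards/SPLIT-weil-neg.md` §9)

Same content as the seat's `SketchG3.lean` (sha16 246a2f526834bbca) with the three abbreviations `level`, `NullFree`,
`NonDegFrom` INLINED (tree expressions verbatim), so that every statement is over tree declarations only (seat's raw file
`SketchG3Raw.lean` sha16 aa69e819b4f32108; referee g2 replay 23:49Z rc 0 / std on `rh_iff_weilPositivityOn_and_nullFree_from`
and `cofiniteCriticalLine_of_nullFree_from`, content PASS; typer-2 g2 H1 std; filed by rh-split-typer-2 g2 with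
`_root_.RiemannHypothesis` spelled out).  No `def`, no `instance`, no notation, no sorry.
Referee labels (23:49Z): S11 ↦ ONE ROW WITH X-1 (δ1 hypothesis-free both directions vs X-1 mod corollary11; δ2 B ⟹ FOZ
unconditional); A = `WeilPositivityOn H` RH-FREE certifiable; B RH-implied, UNDECIDED; T13 ∃-form VACUOUS (theorem of
logic, `heightTransfer_exists`); class (weil, neg) UNCHANGED barrier note; not a survivor.

* `heightTransfer_exists`, `exists_height_of_rh_implied` — VACUITY detector: every RH-implied window predicate
  has a finite-height certificate in the ∃-sense.
* `groundLevel_eq_weilGroundEnergy` — the Courant–Fischer ground level IS `weilGroundEnergy`.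
* `exists_nullVector_of_isWeilOnset` — the onset window form is DEGENERATE (Yoshida 1992, proof of Thm 2).
* `rh_of_weilPositivityOn_of_nullFree_from`, `rh_iff_weilPositivityOn_and_nullFree_from` — S11, hypothesis-free.
* `nullFree_from_iff_rh_of_le_one` — at certified windows the tail IS RH.
* `cofiniteCriticalLine_of_nullFree_from`, `eventuallyNullFree_iff_cofiniteCriticalLine` — B ⟹ FOZ and the
  tree's END ⟺ FOZ, now hypothesis-free (branch continuity = `stub_branchesContinuous`).
* `boundedIndex_split_iff` — "bounded index" as a tail is FOZ as a tail.

SPLITTING SEARCH over kernel-typed RH-EQUIVALENCES; a splitting A ∧ B ⟹ RH is CONDITIONAL bookkeeping unless A and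
B are both proved; nothing here bears on the truth of RH.
-/

noncomputable section

set_option linter.dupNamespace false

open Complex Filter Set MeasureTheory
open scoped Real Topology ComplexConjugate BigOperators
open Literature.NumberTheory.LFunctions
open Literature.NumberTheory.DiophantineGeometry
open Summit.RiemannHypothesis.RiemannHypothesis.Theorems
open Summit.RiemannHypothesis.RiemannHypothesis.Theorems.RuelleBandCofiniteCriticalLine
open Summit.RiemannHypothesis.RiemannHypothesis.Theses.RuelleBand (CofiniteCriticalLine)
open Summit.RiemannHypothesis.RiemannHypothesis.Theorems.WeilFormatCData.A1 (weilPositivityOn_one)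

namespace Summit.RiemannHypothesis.RiemannHypothesis.Theorems.Splittings.WeilNullFreeTail

/-! ## §1 Vacuity of ∃-height certificates -/

/-- Windows `a ≤ 1` are certified: `W_fin(a)` from the rung `weilPositivityOn_one`. -/
theorem weilPositivityOn_of_le_one {a : ℝ} (ha : a ≤ 1) : WeilPositivityOn a :=
  weilPositivityOn_one.mono ha

/-- For EVERY window there is, RH-free, a height `T` with `RH-up-to-T → W_fin(a)`. -/
theorem heightTransfer_exists (a : ℝ) :
    ∃ T : ℝ, (RiemannHypothesisUpTo T → WeilPositivityOn a) := by
  by_cases hW : WeilPositivityOn a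
  · exact ⟨0, fun _ => hW⟩
  · have ha : 0 < a :=
      lt_of_not_ge fun h => hW (weilPositivityOn_of_le_one (le_trans h zero_le_one))
    have hRH : ¬ _root_.RiemannHypothesis := fun h =>
      hW ((riemannHypothesis_iff_forall_weilPositivityOn.1 h) a ha)
    have hT : ¬ ∀ T : ℝ, RiemannHypothesisUpTo T := fun h =>
      hRH ((riemannHypothesis_iff_forall_riemannHypothesisUpTo_holds :
        _root_.RiemannHypothesis ↔ ∀ T : ℝ, RiemannHypothesisUpTo T).2 h)
    obtain ⟨T, hT⟩ := not_forall.mp hT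
    exact ⟨T, fun h => absurd h hT⟩

/-- Schema: ANY RH-implied window predicate `P` satisfies `∀ a, ∃ T, RH-up-to-T → P a`. -/
theorem exists_height_of_rh_implied {P : ℝ → Prop} (hP : _root_.RiemannHypothesis → ∀ a, P a) (a : ℝ) :
    ∃ T : ℝ, (RiemannHypothesisUpTo T → P a) := by
  by_cases h : P a
  · exact ⟨0, fun _ => h⟩
  · have hT : ¬ ∀ T : ℝ, RiemannHypothesisUpTo T := fun hall =>
      h (hP ((riemannHypothesis_iff_forall_riemannHypothesisUpTo_holds :
        _root_.RiemannHypothesis ↔ ∀ T : ℝ, RiemannHypothesisUpTo T).2 hall) a)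
    obtain ⟨T, hT⟩ := not_forall.mp hT
    exact ⟨T, fun h' => absurd h' hT⟩

/-! ## §2 Ground level = ground energy; the onset window is degenerate; S11 -/

/-- A one-term family sum. -/
theorem sum_fin_one_apply (c : Fin (0 + 1) → ℂ) (G : Fin (0 + 1) → ℝ → ℂ) (t : ℝ) :
    ∑ i, c i * G i t = c 0 * G 0 t := by
  simp only [Fin.sum_univ_succ, Fin.sum_univ_zero, add_zero]

/-- `∫ ‖c g‖² = ‖c‖² ∫ ‖g‖²`. -/
theorem integral_norm_sq_const_mul (c : ℂ) (g : ℝ → ℂ) :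
    ∫ t, ‖c * g t‖ ^ 2 = ‖c‖ ^ 2 * ∫ t, ‖g t‖ ^ 2 := by
  simp only [norm_mul, mul_pow]
  rw [integral_const_mul]

/-- The Rayleigh set of a one-element tuple is a singleton. -/
theorem rayleigh_fin_one {G : Fin (0 + 1) → ℝ → ℂ} (hm : 0 < ∫ t, ‖G 0 t‖ ^ 2) :
    {y : ℝ | ∃ c : Fin (0 + 1) → ℂ, ∫ t, ‖∑ i, c i * G i t‖ ^ 2 = (1 : ℝ) ∧
        y = (weilQuadratic (fun t => ∑ i, c i * G i t)).re}
      = {(∫ t, ‖G 0 t‖ ^ 2)⁻¹ * (weilQuadratic (G 0)).re} := by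
  ext y
  simp only [Set.mem_setOf_eq, Set.mem_singleton_iff]
  constructor
  · rintro ⟨c, hc1, rfl⟩
    simp only [sum_fin_one_apply] at hc1 ⊢
    rw [integral_norm_sq_const_mul] at hc1
    rw [weilQuadratic_const_mul, Complex.re_ofReal_mul, Complex.normSq_eq_norm_sq,
      eq_inv_of_mul_eq_one_left hc1]
  · rintro rfl
    set m : ℝ := ∫ t, ‖G 0 t‖ ^ 2 with hm_def
    set c : ℝ := (Real.sqrt m)⁻¹ with hc
    have hcpos : 0 < c := inv_pos.2 (Real.sqrt_pos.2 hm)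
    have hcc : c * c = m⁻¹ := by
      rw [hc, ← mul_inv, Real.mul_self_sqrt hm.le]
    refine ⟨fun _ => (c : ℂ), ?_, ?_⟩
    · simp only [sum_fin_one_apply]
      rw [integral_norm_sq_const_mul, Complex.norm_real, Real.norm_of_nonneg hcpos.le, sq, hcc,
        inv_mul_cancel₀ hm.ne']
    · simp only [sum_fin_one_apply]
      rw [weilQuadratic_const_mul, Complex.normSq_ofReal, Complex.re_ofReal_mul, hcc]

/-- A single non-zero function is a linearly independent one-term family. -/
theorem linearIndependent_fin_one {g : ℝ → ℂ} (hg : g ≠ 0) :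
    LinearIndependent ℂ (fun _ : Fin (0 + 1) => g) := by
  rw [Fintype.linearIndependent_iff]
  intro c hc i
  have h0 : c 0 • g = 0 := by
    simpa only [Fin.sum_univ_succ, Fin.sum_univ_zero, add_zero] using hc
  have hc0 : c 0 = 0 := (smul_eq_zero.1 h0).resolve_right hg
  exact Fin.cases hc0 (fun j => j.elim0) i

/-- **The Courant–Fischer ground level is `weilGroundEnergy`.** -/
theorem groundLevel_eq_weilGroundEnergy (a : ℝ) :
    sInf {x : ℝ | ∃ g : Fin (0 + 1) → ℝ → ℂ,
      (∀ i, IsWeilTest (g i) ∧ tsupport (g i) ⊆ Set.Icc (-a) a) ∧ LinearIndependent ℂ g ∧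
      x = sSup {y : ℝ | ∃ c : Fin (0 + 1) → ℂ,
        ∫ t, ‖∑ i, c i * g i t‖ ^ 2 = (1 : ℝ) ∧
        y = (weilQuadratic (fun t => ∑ i, c i * g i t)).re}} = weilGroundEnergy a := by
  unfold weilGroundEnergy
  congr 1
  ext x
  simp only [Set.mem_setOf_eq]
  constructor
  · rintro ⟨G, hG, hli, rfl⟩
    have hG0 : G 0 ≠ 0 := hli.ne_zero 0
    have hnn : 0 ≤ ∫ t, ‖G 0 t‖ ^ 2 := integral_nonneg fun _ => by positivity
    have hm : 0 < ∫ t, ‖G 0 t‖ ^ 2 := lt_of_le_of_ne hnn fun h =>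
      hG0 ((hG 0).1.eq_zero_of_integral_norm_sq_eq_zero h.symm)
    rw [rayleigh_fin_one hm, csSup_singleton]
    set m : ℝ := ∫ t, ‖G 0 t‖ ^ 2 with hm_def
    set c : ℝ := (Real.sqrt m)⁻¹ with hc
    have hcpos : 0 < c := inv_pos.2 (Real.sqrt_pos.2 hm)
    have hcc : c * c = m⁻¹ := by
      rw [hc, ← mul_inv, Real.mul_self_sqrt hm.le]
    refine ⟨fun t => (c : ℂ) * G 0 t, (hG 0).1.const_mul c,
      tsupport_mul_subset_right.trans (hG 0).2, ?_, ?_⟩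
    · rw [integral_norm_sq_const_mul, Complex.norm_real, Real.norm_of_nonneg hcpos.le, sq, hcc,
        inv_mul_cancel₀ hm.ne']
    · rw [weilQuadratic_const_mul, Complex.normSq_ofReal, Complex.re_ofReal_mul, hcc]
  · rintro ⟨g, hg, hsupp, hnorm, rfl⟩
    have hg0 : g ≠ 0 := by
      rintro rfl
      simp at hnorm
    refine ⟨fun _ => g, fun _ => ⟨hg, hsupp⟩, linearIndependent_fin_one hg0, ?_⟩
    have hm : 0 < ∫ t, ‖(fun _ : Fin (0 + 1) => g) 0 t‖ ^ 2 := by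
      show 0 < ∫ t, ‖g t‖ ^ 2
      rw [hnorm]; exact one_pos
    rw [rayleigh_fin_one hm, csSup_singleton]
    show (weilQuadratic g).re = (∫ t, ‖g t‖ ^ 2)⁻¹ * (weilQuadratic g).re
    rw [hnorm, inv_one, one_mul]


/-- **The onset window form is degenerate** (non-zero L²-null vector; Yoshida 1992, proof of Thm 2). -/
theorem exists_nullVector_of_isWeilOnset {a₀ : ℝ} (h : IsWeilOnset a₀) :
    ∃ (u : ℝ → ℂ) (g : ℕ → ℝ → ℂ), MemLp u 2 volume ∧ ¬ (u =ᵐ[volume] 0) ∧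
      (∀ n, IsWeilTest (g n) ∧ tsupport (g n) ⊆ Set.Icc (-a₀) a₀) ∧
      Tendsto (fun n => ∫ t, ‖g n t - u t‖ ^ 2) atTop (𝓝 0) ∧
      Tendsto (fun q : ℕ × ℕ => (weilQuadratic (g q.1 - g q.2)).re) atTop (𝓝 0) ∧
      ∀ h : ℝ → ℂ, IsWeilTest h → tsupport h ⊆ Set.Icc (-a₀) a₀ →
        Tendsto (fun n => weilFunctional (weilConv (g n) (weilReflect h))) atTop (𝓝 0) :=
  stub_zeroLevelNullVector 0 a₀ h.pos (by rw [groundLevel_eq_weilGroundEnergy]; exact h.eq_zero)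

/-- **S11, A ∧ B ⟹ RH**: Weil positivity at window `H` and null-freeness of every closed window form `a ≥ H`
give RH (no hypothesis on `H`, no vendored fact). -/
theorem rh_of_weilPositivityOn_of_nullFree_from {H : ℝ} (hA : WeilPositivityOn H)
    (hB : ∀ a : ℝ, H ≤ a → ¬ ∃ (u : ℝ → ℂ) (g : ℕ → ℝ → ℂ), MemLp u 2 volume ∧ ¬ (u =ᵐ[volume] 0) ∧
      (∀ n, IsWeilTest (g n) ∧ tsupport (g n) ⊆ Set.Icc (-a) a) ∧
      Tendsto (fun n => ∫ t, ‖g n t - u t‖ ^ 2) atTop (𝓝 0) ∧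
      Tendsto (fun q : ℕ × ℕ => (weilQuadratic (g q.1 - g q.2)).re) atTop (𝓝 0) ∧
      ∀ h : ℝ → ℂ, IsWeilTest h → tsupport h ⊆ Set.Icc (-a) a →
        Tendsto (fun n => weilFunctional (weilConv (g n) (weilReflect h))) atTop (𝓝 0)) :
    _root_.RiemannHypothesis := by
  by_contra hRH
  obtain ⟨a₀, ha₀⟩ := exists_isWeilOnset_of_not_riemannHypothesis hRH
  exact hB a₀ (ha₀.le_of_weilPositivityOn hA) (exists_nullVector_of_isWeilOnset ha₀)

/-- **S11 as an RH-equivalence at every window `H > 0`.** -/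
theorem rh_iff_weilPositivityOn_and_nullFree_from {H : ℝ} (hH : 0 < H) :
    _root_.RiemannHypothesis ↔ (WeilPositivityOn H ∧
      ∀ a : ℝ, H ≤ a → ¬ ∃ (u : ℝ → ℂ) (g : ℕ → ℝ → ℂ), MemLp u 2 volume ∧ ¬ (u =ᵐ[volume] 0) ∧
      (∀ n, IsWeilTest (g n) ∧ tsupport (g n) ⊆ Set.Icc (-a) a) ∧
      Tendsto (fun n => ∫ t, ‖g n t - u t‖ ^ 2) atTop (𝓝 0) ∧
      Tendsto (fun q : ℕ × ℕ => (weilQuadratic (g q.1 - g q.2)).re) atTop (𝓝 0) ∧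
      ∀ h : ℝ → ℂ, IsWeilTest h → tsupport h ⊆ Set.Icc (-a) a →
        Tendsto (fun n => weilFunctional (weilConv (g n) (weilReflect h))) atTop (𝓝 0)) :=
  ⟨fun h => ⟨(riemannHypothesis_iff_forall_weilPositivityOn.1 h) H hH,
      fun a ha => stub_calibration_END_of_RH h a (hH.trans_le ha)⟩,
    fun h => rh_of_weilPositivityOn_of_nullFree_from h.1 h.2⟩

/-- At certified windows `H ≤ 1` the tail IS RH (the rung `weilPositivityOn_one` is decoration). -/
theorem nullFree_from_iff_rh_of_le_one {H : ℝ} (hH : 0 < H) (h1 : H ≤ 1) :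
    (∀ a : ℝ, H ≤ a → ¬ ∃ (u : ℝ → ℂ) (g : ℕ → ℝ → ℂ), MemLp u 2 volume ∧ ¬ (u =ᵐ[volume] 0) ∧
      (∀ n, IsWeilTest (g n) ∧ tsupport (g n) ⊆ Set.Icc (-a) a) ∧
      Tendsto (fun n => ∫ t, ‖g n t - u t‖ ^ 2) atTop (𝓝 0) ∧
      Tendsto (fun q : ℕ × ℕ => (weilQuadratic (g q.1 - g q.2)).re) atTop (𝓝 0) ∧
      ∀ h : ℝ → ℂ, IsWeilTest h → tsupport h ⊆ Set.Icc (-a) a →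
        Tendsto (fun n => weilFunctional (weilConv (g n) (weilReflect h))) atTop (𝓝 0)) ↔ _root_.RiemannHypothesis :=
  ⟨rh_of_weilPositivityOn_of_nullFree_from (weilPositivityOn_of_le_one h1),
    fun h a ha => stub_calibration_END_of_RH h a (hH.trans_le ha)⟩

/-- **B ⟹ FOZ, hypothesis-free** (branch continuity = tree theorem `stub_branchesContinuous`). -/
theorem cofiniteCriticalLine_of_nullFree_from {H : ℝ}
    (hB : ∀ a : ℝ, H ≤ a → ¬ ∃ (u : ℝ → ℂ) (g : ℕ → ℝ → ℂ), MemLp u 2 volume ∧ ¬ (u =ᵐ[volume] 0) ∧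
      (∀ n, IsWeilTest (g n) ∧ tsupport (g n) ⊆ Set.Icc (-a) a) ∧
      Tendsto (fun n => ∫ t, ‖g n t - u t‖ ^ 2) atTop (𝓝 0) ∧
      Tendsto (fun q : ℕ × ℕ => (weilQuadratic (g q.1 - g q.2)).re) atTop (𝓝 0) ∧
      ∀ h : ℝ → ℂ, IsWeilTest h → tsupport h ⊆ Set.Icc (-a) a →
        Tendsto (fun n => weilFunctional (weilConv (g n) (weilReflect h))) atTop (𝓝 0)) :
    CofiniteCriticalLine :=
  cofiniteCriticalLine_of_END stub_branchesContinuous ⟨H, hB⟩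

/-- The tree's END ⟺ FOZ with its branch-continuity hypothesis DISCHARGED. -/
theorem eventuallyNullFree_iff_cofiniteCriticalLine :
    (∃ a₀ : ℝ, ∀ a : ℝ, a₀ ≤ a → ¬ ∃ (u : ℝ → ℂ) (g : ℕ → ℝ → ℂ), MemLp u 2 volume ∧ ¬ (u =ᵐ[volume] 0) ∧
      (∀ n, IsWeilTest (g n) ∧ tsupport (g n) ⊆ Set.Icc (-a) a) ∧
      Tendsto (fun n => ∫ t, ‖g n t - u t‖ ^ 2) atTop (𝓝 0) ∧
      Tendsto (fun q : ℕ × ℕ => (weilQuadratic (g q.1 - g q.2)).re) atTop (𝓝 0) ∧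
      ∀ h : ℝ → ℂ, IsWeilTest h → tsupport h ⊆ Set.Icc (-a) a →
        Tendsto (fun n => weilFunctional (weilConv (g n) (weilReflect h))) atTop (𝓝 0)) ↔ CofiniteCriticalLine :=
  END_iff_cofiniteCriticalLine stub_branchesContinuous

/-- Non-degeneracy from `H` forces `ε(a) ≠ 0` for all `a ≥ H` (the g0 card's `TailND`). -/
theorem weilGroundEnergy_ne_zero_of_nullFree_from {H : ℝ}
    (hB : ∀ a : ℝ, H ≤ a → ¬ ∃ (u : ℝ → ℂ) (g : ℕ → ℝ → ℂ), MemLp u 2 volume ∧ ¬ (u =ᵐ[volume] 0) ∧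
      (∀ n, IsWeilTest (g n) ∧ tsupport (g n) ⊆ Set.Icc (-a) a) ∧
      Tendsto (fun n => ∫ t, ‖g n t - u t‖ ^ 2) atTop (𝓝 0) ∧
      Tendsto (fun q : ℕ × ℕ => (weilQuadratic (g q.1 - g q.2)).re) atTop (𝓝 0) ∧
      ∀ h : ℝ → ℂ, IsWeilTest h → tsupport h ⊆ Set.Icc (-a) a →
        Tendsto (fun n => weilFunctional (weilConv (g n) (weilReflect h))) atTop (𝓝 0))
    {a : ℝ} (ha : 0 < a) (hHa : H ≤ a) : weilGroundEnergy a ≠ 0 := fun h0 =>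
  hB a hHa (stub_zeroLevelNullVector 0 a ha (by rw [groundLevel_eq_weilGroundEnergy]; exact h0))

/-! ## §3 "Bounded index" as a tail is FOZ as a tail -/

/-- «Bounded index» as a tail conjunct: the split `W_fin(H) ∧ (∃ N, every (N+1)-family has a non-negative direction) ⟹ RH`
holds iff the FOZ split `W_fin(H) ∧ CofiniteCriticalLine ⟹ RH` holds (the tree's bounded-index ⟺ FOZ anchor). -/
theorem boundedIndex_split_iff (H : ℝ) :
    (WeilPositivityOn H ∧ (∃ N : ℕ, ∀ (a : ℝ) (g : Fin (N + 1) → ℝ → ℂ),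
      (∀ i, IsWeilTest (g i)) → (∀ i, tsupport (g i) ⊆ Set.Icc (-a) a) →
      ∃ c : Fin (N + 1) → ℂ, c ≠ 0 ∧ 0 ≤ (weilQuadratic (fun t => ∑ i, c i * g i t)).re) → _root_.RiemannHypothesis) ↔
      (WeilPositivityOn H ∧ CofiniteCriticalLine → _root_.RiemannHypothesis) := by
  rw [boundedWeilIndex_iff_cofiniteCriticalLine]

end Summit.RiemannHypothesis.RiemannHypothesis.Theorems.Splittings.WeilNullFreeTail

end
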